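import Mathlib.Analysis.Calculus.ParametricIntegral
import Mathlib.MeasureTheory.Integral.IntervalIntegral.FundThmCalculus
import Literature.Geometry.Lorentzian.CoordCurvatureNormEvolution
import Literature.Geometry.Lorentzian.CoordEnergyEstimate
import HarnessLib

/-!
# The energy of two Ricci flows on one chart: time evolution (Kotschwar 2014, Prop. 7, in time)

Time-dependent layer over `CoordEnergyEstimate.lean`. Two smooth one-parameter families of
metric components `G, G' : ℝ → E → (E →L E →L ℝ)` on `V × S` (`IsMetricFamilyOn`) solving the
Ricci flow in coordinates, `∂G/∂t = −2 Ric(G)` and `∂G'/∂t = −2 Ric(G')` on `V × S`. We prove: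

* joint smoothness on `V × S` of every quantity entering the energy argument (`Ric`, `DRic`,
  `D²Ric`, `∇Ric`, `D∇Ric`, `Π`, the evolution right-hand side `Λ(G)`), hence joint continuity of
  the energy density `e = eDens` and of its formal time derivative `eDeriv`, and the existence
  of a common bound `N` of the background quantities (`PairBound`) on `K × S`, `K ⊆ V` compact;
* `quadratic_ginv_pos` — positive definiteness of `g^{ij}` for a positive definite `G`;
* **`IsMetricFamilyOn.hasDerivWithinAt_eDens`** — along the two flows the energy density has,
  within `S`, the time derivative `eDeriv` (`∂_t H = −2P`, `∂_t A = Π − Π'` by Topping's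
  Prop. 2.3.1 under the flow, `∂_t P = Λ(G) − Λ(G')` by Hamilton's Cor. 7.3 in coordinates,
  `CoordRicciEvolution.hasDerivWithinAt_ricAt_ricciFlow`);
* **`IsMetricFamilyOn.energy_le`** — the integrated localized energy inequality on `S = [0, T]`:
  for a `C¹` cut-off `ρ` with compact support in `V`,

  `∫ ρ² e(t) dμ ≤ ∫ ρ² e(0) dμ + C ∫₀ᵗ ∫_{tsupport ρ} e(s) dμ ds`  (`t ∈ [0, T]`),

  with the constant `C = energyConst` of `integral_rhoSq_eDeriv_le` (differentiation under the
  integral sign at interior times, the fundamental theorem of calculus on `[0, t]`, and the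
  localized energy inequality at each time), together with the continuity in `t` of the chart
  energies used downstream.

Everything is proved; no definition of `Prop` type is introduced.

## References

* B. Kotschwar, *An energy approach to the problem of uniqueness for the Ricci flow*,
  Comm. Anal. Geom. 22 (2014) 149–176 (arXiv:1206.3225), §2.3, Prop. 7; §1.1 (5)–(10).
  [Kotschwar2014]
* R. S. Hamilton, *Three-manifolds with positive Ricci curvature*, J. Differential Geom. 17
  (1982), Cor. 7.3. [Hamilton1982]
* P. Topping, *Lectures on the Ricci flow*, LMS LNS 325, CUP 2006, Prop. 2.3.1, §1.2.3. [Topping2006]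
-/

noncomputable section

set_option maxSynthPendingDepth 3

open Set Filter ContinuousLinearMap Module MeasureTheory Function
open scoped Topology ContDiff

namespace Literature.Geometry.Lorentzian

namespace MetricCoord

variable {E : Type*} [NormedAddCommGroup E] [NormedSpace ℝ E]

/-! ### Joint smoothness of the curvature quantities of a smooth family -/

namespace IsMetricFamilyOn

section FamilyRegularity

variable [FiniteDimensional ℝ E] [CompleteSpace E]
  {G : ℝ → E → E →L[ℝ] E →L[ℝ] ℝ} {S : Set ℝ} {V : Set E}

omit [FiniteDimensional ℝ E] [CompleteSpace E] in
/-- `(y, t) ↦ D_y G_t` is `C^∞` on `V × S`. [folklore] -/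
theorem contDiffOn_fderiv_family (hG : IsMetricFamilyOn G S V) :
    ContDiffOn ℝ ∞ (fun q : E × ℝ ↦ fderiv ℝ (G q.2) q.1) (V ×ˢ S) := by
  by_cases hS : S = ∅
  · simp [hS]
  obtain ⟨t₀, ht₀⟩ := Set.nonempty_iff_ne_empty.mpr hS
  exact contDiffOn_fderiv_slice (F := fun p : E × ℝ ↦ G p.2 p.1) (hG.isOpen ht₀) hG.uniqueDiffOn
    hG.contDiffOn

omit [FiniteDimensional ℝ E] in
/-- `(y, t) ↦ D_y Γ_t` is `C^∞` on `V × S`. [folklore] -/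
theorem contDiffOn_fderiv_chrAt_family (hG : IsMetricFamilyOn G S V) :
    ContDiffOn ℝ ∞ (fun q : E × ℝ ↦ fderiv ℝ (chrAt (G q.2)) q.1) (V ×ˢ S) := by
  by_cases hS : S = ∅
  · simp [hS]
  obtain ⟨t₀, ht₀⟩ := Set.nonempty_iff_ne_empty.mpr hS
  exact contDiffOn_fderiv_slice (F := fun q : E × ℝ ↦ chrAt (G q.2) q.1) (hG.isOpen ht₀)
    hG.uniqueDiffOn hG.contDiffOn_chrAt_family

/-- **`(y, t) ↦ Ric_t(y)` is `C^∞` on `V × S`** as a map into bilinear forms (componentwise,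
`Ric(Y,Z) = Σᵢ bⁱ(R(bᵢ,Y)Z)` and the joint smoothness of `R`). [cite: Topping2006, §1.2.3] -/
theorem contDiffOn_ricAt_family (hG : IsMetricFamilyOn G S V) :
    ContDiffOn ℝ ∞ (fun q : E × ℝ ↦ ricAt (G q.2) q.1) (V ×ˢ S) := by
  set b := Module.finBasis ℝ E
  refine contDiffOn_clm_apply.2 fun Y ↦ contDiffOn_clm_apply.2 fun Z ↦ ?_
  have heq : (fun q : E × ℝ ↦ ricAt (G q.2) q.1 Y Z) =
      fun q ↦ ∑ i, coordCLM b i (riemAt (G q.2) q.1 (b i) Y Z) :=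
    funext fun q ↦ ricAt_eq_sum_coord b Y Z
  rw [heq]
  exact ContDiffOn.sum fun i _ ↦ (coordCLM b i).contDiff.comp_contDiffOn
    ((hG.contDiffOn_riemAt_family (b i) Y).clm_apply contDiffOn_const)

/-- `(y, t) ↦ D_y Ric_t` is `C^∞` on `V × S`. [folklore] -/
theorem contDiffOn_fderiv_ricAt_family (hG : IsMetricFamilyOn G S V) :
    ContDiffOn ℝ ∞ (fun q : E × ℝ ↦ fderiv ℝ (ricAt (G q.2)) q.1) (V ×ˢ S) := by
  by_cases hS : S = ∅
  · simp [hS]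
  obtain ⟨t₀, ht₀⟩ := Set.nonempty_iff_ne_empty.mpr hS
  exact contDiffOn_fderiv_slice (F := fun q : E × ℝ ↦ ricAt (G q.2) q.1) (hG.isOpen ht₀)
    hG.uniqueDiffOn hG.contDiffOn_ricAt_family

/-- `(y, t) ↦ D²_y Ric_t` is `C^∞` on `V × S`. [folklore] -/
theorem contDiffOn_fderiv_fderiv_ricAt_family (hG : IsMetricFamilyOn G S V) :
    ContDiffOn ℝ ∞ (fun q : E × ℝ ↦ fderiv ℝ (fderiv ℝ (ricAt (G q.2))) q.1) (V ×ˢ S) := by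
  by_cases hS : S = ∅
  · simp [hS]
  obtain ⟨t₀, ht₀⟩ := Set.nonempty_iff_ne_empty.mpr hS
  exact contDiffOn_fderiv_slice (F := fun q : E × ℝ ↦ fderiv ℝ (ricAt (G q.2)) q.1) (hG.isOpen ht₀)
    hG.uniqueDiffOn hG.contDiffOn_fderiv_ricAt_family

/-- **`(y, t) ↦ (∇Ric)_t(y)` is `C^∞` on `V × S`** (the formula `cov₂At_eq`). [folklore] -/
theorem contDiffOn_cov₂At_ricAt_family (hG : IsMetricFamilyOn G S V) :
    ContDiffOn ℝ ∞ (fun q : E × ℝ ↦ cov₂At (G q.2) (ricAt (G q.2)) q.1) (V ×ˢ S) := by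
  have hR := hG.contDiffOn_ricAt_family
  have hDR := hG.contDiffOn_fderiv_ricAt_family
  have hΓ := hG.contDiffOn_chrAt_family
  have hA : ContDiffOn ℝ ∞ (fun q : E × ℝ ↦
      (ContinuousLinearMap.compL ℝ E E (E →L[ℝ] ℝ) (ricAt (G q.2) q.1)).comp (chrAt (G q.2) q.1)) (V ×ˢ S) :=
    ((ContinuousLinearMap.compL ℝ E E (E →L[ℝ] ℝ)).contDiff.comp_contDiffOn hR).clm_comp hΓ
  have hflip : ContDiffOn ℝ ∞ (fun q : E × ℝ ↦ (ricAt (G q.2) q.1).flip) (V ×ˢ S) :=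
    (ContinuousLinearMap.flipₗᵢ ℝ E E ℝ).contDiff.comp_contDiffOn hR
  have hB : ContDiffOn ℝ ∞ (fun q : E × ℝ ↦
      flipCLM.comp ((ContinuousLinearMap.compL ℝ E E (E →L[ℝ] ℝ) (ricAt (G q.2) q.1).flip).comp
        (chrAt (G q.2) q.1))) (V ×ˢ S) :=
    contDiffOn_const.clm_comp
      (((ContinuousLinearMap.compL ℝ E E (E →L[ℝ] ℝ)).contDiff.comp_contDiffOn hflip).clm_comp hΓ)
  have heq : (fun q : E × ℝ ↦ cov₂At (G q.2) (ricAt (G q.2)) q.1) = fun q ↦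
      fderiv ℝ (ricAt (G q.2)) q.1
        - (ContinuousLinearMap.compL ℝ E E (E →L[ℝ] ℝ) (ricAt (G q.2) q.1)).comp (chrAt (G q.2) q.1)
        - flipCLM.comp ((ContinuousLinearMap.compL ℝ E E (E →L[ℝ] ℝ) (ricAt (G q.2) q.1).flip).comp
          (chrAt (G q.2) q.1)) := by
    funext q
    rw [cov₂At_eq]
  rw [heq]
  exact (hDR.sub hA).sub hB

/-- `(y, t) ↦ D_y (∇Ric)_t` is `C^∞` on `V × S`. [folklore] -/
theorem contDiffOn_fderiv_cov₂At_ricAt_family (hG : IsMetricFamilyOn G S V) :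
    ContDiffOn ℝ ∞ (fun q : E × ℝ ↦ fderiv ℝ (cov₂At (G q.2) (ricAt (G q.2))) q.1) (V ×ˢ S) := by
  by_cases hS : S = ∅
  · simp [hS]
  obtain ⟨t₀, ht₀⟩ := Set.nonempty_iff_ne_empty.mpr hS
  exact contDiffOn_fderiv_slice (F := fun q : E × ℝ ↦ cov₂At (G q.2) (ricAt (G q.2)) q.1)
    (hG.isOpen ht₀) hG.uniqueDiffOn hG.contDiffOn_cov₂At_ricAt_family

/-- `(y, t) ↦ g^{ij}_t(y)` is `C^∞` on `V × S`. [folklore] -/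
theorem contDiffOn_ginv_family {ι : Type*} (b : Basis ι ℝ E) (hG : IsMetricFamilyOn G S V) (i j : ι) :
    ContDiffOn ℝ ∞ (fun q : E × ℝ ↦ ginv (G q.2) b q.1 i j) (V ×ˢ S) :=
  (coordCLM b i).contDiff.comp_contDiffOn (hG.contDiffOn_sharpAt_family.clm_apply contDiffOn_const)

/-- `(y, t) ↦ Π_t(y) = piFlowAt (G t) y` is `C^∞` on `V × S`. [folklore] -/
theorem contDiffOn_piFlowAt_family (hG : IsMetricFamilyOn G S V) :
    ContDiffOn ℝ ∞ (fun q : E × ℝ ↦ piFlowAt (G q.2) q.1) (V ×ˢ S) := by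
  have hC := hG.contDiffOn_cov₂At_ricAt_family
  have hκ : ContDiffOn ℝ ∞ (fun q : E × ℝ ↦ kappaAt (G q.2) q.1) (V ×ˢ S) := by
    have h1 : ContDiffOn ℝ ∞ (fun q : E × ℝ ↦ swap₁₂ (cov₂At (G q.2) (ricAt (G q.2)) q.1)) (V ×ˢ S) :=
      (swap₁₂ (E := E)).contDiff.comp_contDiffOn hC
    have h2 : ContDiffOn ℝ ∞ (fun q : E × ℝ ↦ swap₂₃ (swap₁₂ (cov₂At (G q.2) (ricAt (G q.2)) q.1)))
        (V ×ˢ S) :=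
      (swap₂₃ (E := E)).contDiff.comp_contDiffOn h1
    exact (hC.add h1).sub h2
  have hL : ContDiffOn ℝ ∞ (fun q : E × ℝ ↦
      ContinuousLinearMap.compL ℝ E (E →L[ℝ] ℝ) E (sharpAt (G q.2) q.1)) (V ×ˢ S) :=
    (ContinuousLinearMap.compL ℝ E (E →L[ℝ] ℝ) E).contDiff.comp_contDiffOn hG.contDiffOn_sharpAt_family
  exact (hL.clm_comp hκ).neg

/-- `(y, t) ↦ Λ(G_t)(y)(Y, Z) = ricEvolAt b (G t) y Y Z` is `C^∞` on `V × S`. [folklore] -/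
theorem contDiffOn_ricEvolAt_family {ι : Type*} [Fintype ι] (b : Basis ι ℝ E)
    (hG : IsMetricFamilyOn G S V) (Y Z : E) :
    ContDiffOn ℝ ∞ (fun q : E × ℝ ↦ ricEvolAt b (G q.2) q.1 Y Z) (V ×ˢ S) := by
  have hC := hG.contDiffOn_cov₂At_ricAt_family
  have hDC := hG.contDiffOn_fderiv_cov₂At_ricAt_family
  have hΓ := hG.contDiffOn_chrAt_family
  have hR := hG.contDiffOn_ricAt_family
  have hRm := fun X Y ↦ hG.contDiffOn_riemAt_family X Y
  have hg := fun i j ↦ hG.contDiffOn_ginv_family b i j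
  -- the Laplacian part
  have hlap : ContDiffOn ℝ ∞ (fun q : E × ℝ ↦ lapBilinAt (G q.2) (ricAt (G q.2)) q.1 Y Z) (V ×ˢ S) := by
    have heq : (fun q : E × ℝ ↦ lapBilinAt (G q.2) (ricAt (G q.2)) q.1 Y Z) = fun q ↦ ∑ k, ∑ l,
        ginv (G q.2) b q.1 k l *
          (fderiv ℝ (cov₂At (G q.2) (ricAt (G q.2))) q.1 (b k) (b l) Y Z
            - cov₂At (G q.2) (ricAt (G q.2)) q.1 (chrAt (G q.2) q.1 (b k) (b l)) Y Z
            - cov₂At (G q.2) (ricAt (G q.2)) q.1 (b l) (chrAt (G q.2) q.1 (b k) Y) Z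
            - cov₂At (G q.2) (ricAt (G q.2)) q.1 (b l) Y (chrAt (G q.2) q.1 (b k) Z)) := by
      funext q
      rw [lapBilinAt_apply_eq_sum (G q.2) (ricAt (G q.2)) b]
      simp only [cov₃At_apply]
    rw [heq]
    refine ContDiffOn.sum fun k _ ↦ ContDiffOn.sum fun l _ ↦ (hg k l).mul ?_
    refine ((ContDiffOn.sub (ContDiffOn.sub ?_ ?_) ?_).sub ?_)
    · exact (((hDC.clm_apply contDiffOn_const).clm_apply contDiffOn_const).clm_apply
        contDiffOn_const).clm_apply contDiffOn_const
    · exact ((hC.clm_apply ((hΓ.clm_apply contDiffOn_const).clm_apply contDiffOn_const)).clm_apply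
        contDiffOn_const).clm_apply contDiffOn_const
    · exact ((hC.clm_apply contDiffOn_const).clm_apply
        ((hΓ.clm_apply contDiffOn_const).clm_apply contDiffOn_const)).clm_apply contDiffOn_const
    · exact ((hC.clm_apply contDiffOn_const).clm_apply contDiffOn_const).clm_apply
        ((hΓ.clm_apply contDiffOn_const).clm_apply contDiffOn_const)
  -- the reaction part
  have hreact : ContDiffOn ℝ ∞ (fun q : E × ℝ ↦ ricReactAt b (G q.2) q.1 Y Z) (V ×ˢ S) := by
    unfold ricReactAt reactTerm
    refine ContDiffOn.sum fun i _ ↦ ContDiffOn.sum fun j _ ↦ (hg i j).mul ?_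
    refine ((ContDiffOn.add (ContDiffOn.add ?_ ?_) ?_).add ?_)
    · exact (hR.clm_apply ((hRm _ _).clm_apply contDiffOn_const)).clm_apply contDiffOn_const
    · exact (hR.clm_apply ((hRm _ _).clm_apply contDiffOn_const)).clm_apply contDiffOn_const
    · exact (hR.clm_apply contDiffOn_const).clm_apply ((hRm _ _).clm_apply contDiffOn_const)
    · exact (hR.clm_apply contDiffOn_const).clm_apply ((hRm _ _).clm_apply contDiffOn_const)
  exact hlap.add hreact

end FamilyRegularity

end IsMetricFamilyOn

/-! ### Joint continuity of the energy density and of its time derivative; uniform bounds -/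

section PairRegularity

variable {ι : Type*} [Fintype ι] [FiniteDimensional ℝ E] [CompleteSpace E] (b : Basis ι ℝ E)
  {G G' : ℝ → E → E →L[ℝ] E →L[ℝ] ℝ} {S : Set ℝ} {V : Set E}

/-- **The energy density of two smooth families is jointly continuous** on `V × S`. [folklore] -/
theorem IsMetricFamilyOn.continuousOn_eDens_family (hG : IsMetricFamilyOn G S V)
    (hG' : IsMetricFamilyOn G' S V) :
    ContinuousOn (fun q : E × ℝ ↦ eDens b (G q.2) (G' q.2) q.1) (V ×ˢ S) := by
  have hH : ContinuousOn (fun q : E × ℝ ↦ G q.2 q.1 - G' q.2 q.1) (V ×ˢ S) :=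
    hG.contDiffOn.continuousOn.sub hG'.contDiffOn.continuousOn
  have hA : ContinuousOn (fun q : E × ℝ ↦ chrDiff (G q.2) (G' q.2) q.1) (V ×ˢ S) :=
    hG.contDiffOn_chrAt_family.continuousOn.sub hG'.contDiffOn_chrAt_family.continuousOn
  have hP : ContinuousOn (fun q : E × ℝ ↦ ricDiff (G q.2) (G' q.2) q.1) (V ×ˢ S) :=
    hG.contDiffOn_ricAt_family.continuousOn.sub hG'.contDiffOn_ricAt_family.continuousOn
  change ContinuousOn (fun q : E × ℝ ↦ ∑ p, hComp b (G q.2) (G' q.2) q.1 p ^ 2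
    + ∑ t, aComp b (G q.2) (G' q.2) q.1 t ^ 2 + ∑ p, pComp b (G q.2) (G' q.2) q.1 p ^ 2) (V ×ˢ S)
  refine ((continuousOn_finsetSum _ fun p _ ↦ ?_).add (continuousOn_finsetSum _ fun t _ ↦ ?_)).add
    (continuousOn_finsetSum _ fun p _ ↦ ?_)
  · exact ((hH.clm_apply continuousOn_const).clm_apply continuousOn_const).pow 2
  · exact ((coordCLM b t.2.2).continuous.comp_continuousOn
      ((hA.clm_apply continuousOn_const).clm_apply continuousOn_const)).pow 2
  · exact ((hP.clm_apply continuousOn_const).clm_apply continuousOn_const).pow 2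

/-- **The formal time derivative of the energy density is jointly continuous** on `V × S`.
[folklore] -/
theorem IsMetricFamilyOn.continuousOn_eDeriv_family (hG : IsMetricFamilyOn G S V)
    (hG' : IsMetricFamilyOn G' S V) :
    ContinuousOn (fun q : E × ℝ ↦ eDeriv b (G q.2) (G' q.2) q.1) (V ×ˢ S) := by
  have hH : ContinuousOn (fun q : E × ℝ ↦ G q.2 q.1 - G' q.2 q.1) (V ×ˢ S) :=
    hG.contDiffOn.continuousOn.sub hG'.contDiffOn.continuousOn
  have hA : ContinuousOn (fun q : E × ℝ ↦ chrDiff (G q.2) (G' q.2) q.1) (V ×ˢ S) :=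
    hG.contDiffOn_chrAt_family.continuousOn.sub hG'.contDiffOn_chrAt_family.continuousOn
  have hP : ContinuousOn (fun q : E × ℝ ↦ ricDiff (G q.2) (G' q.2) q.1) (V ×ˢ S) :=
    hG.contDiffOn_ricAt_family.continuousOn.sub hG'.contDiffOn_ricAt_family.continuousOn
  have hPi : ContinuousOn (fun q : E × ℝ ↦ piFlowAt (G q.2) q.1 - piFlowAt (G' q.2) q.1) (V ×ˢ S) :=
    hG.contDiffOn_piFlowAt_family.continuousOn.sub hG'.contDiffOn_piFlowAt_family.continuousOn
  have hΛ : ∀ Y Z, ContinuousOn (fun q : E × ℝ ↦ ricEvolAt b (G q.2) q.1 Y Z - ricEvolAt b (G' q.2) q.1 Y Z)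
      (V ×ˢ S) := fun Y Z ↦
    (hG.contDiffOn_ricEvolAt_family b Y Z).continuousOn.sub (hG'.contDiffOn_ricEvolAt_family b Y Z).continuousOn
  have hh : ∀ p, ContinuousOn (fun q : E × ℝ ↦ hComp b (G q.2) (G' q.2) q.1 p) (V ×ˢ S) := fun p ↦
    (hH.clm_apply continuousOn_const).clm_apply continuousOn_const
  have ha : ∀ t, ContinuousOn (fun q : E × ℝ ↦ aComp b (G q.2) (G' q.2) q.1 t) (V ×ˢ S) := fun t ↦
    (coordCLM b t.2.2).continuous.comp_continuousOn ((hA.clm_apply continuousOn_const).clm_apply continuousOn_const)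
  have hp : ∀ p, ContinuousOn (fun q : E × ℝ ↦ pComp b (G q.2) (G' q.2) q.1 p) (V ×ˢ S) := fun p ↦
    (hP.clm_apply continuousOn_const).clm_apply continuousOn_const
  have hπ : ∀ t, ContinuousOn (fun q : E × ℝ ↦ piComp b (G q.2) (G' q.2) q.1 t) (V ×ˢ S) := fun t ↦
    (coordCLM b t.2.2).continuous.comp_continuousOn ((hPi.clm_apply continuousOn_const).clm_apply continuousOn_const)
  change ContinuousOn (fun q : E × ℝ ↦
    ∑ p, 2 * hComp b (G q.2) (G' q.2) q.1 p * (-2 * pComp b (G q.2) (G' q.2) q.1 p)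
    + ∑ t, 2 * aComp b (G q.2) (G' q.2) q.1 t * piComp b (G q.2) (G' q.2) q.1 t
    + ∑ p, 2 * pComp b (G q.2) (G' q.2) q.1 p *
        (ricEvolAt b (G q.2) q.1 (b p.1) (b p.2) - ricEvolAt b (G' q.2) q.1 (b p.1) (b p.2))) (V ×ˢ S)
  refine ((continuousOn_finsetSum _ fun p _ ↦ ?_).add (continuousOn_finsetSum _ fun t _ ↦ ?_)).add
    (continuousOn_finsetSum _ fun p _ ↦ ?_)
  · exact (continuousOn_const.mul (hh p)).mul (continuousOn_const.mul (hp p))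
  · exact (continuousOn_const.mul (ha t)).mul (hπ t)
  · exact (continuousOn_const.mul (hp p)).mul (hΛ _ _)

omit [Fintype ι] in
/-- **A common bound for the background quantities on a compact set.** If `K ⊆ V` and `S` are
compact, there is `N` with `PairBound b (G t) (G' t) y N` for all `y ∈ K`, `t ∈ S` (every field is
jointly continuous on `V × S`). [folklore] -/
theorem IsMetricFamilyOn.exists_pairBound [Finite ι] (hG : IsMetricFamilyOn G S V)
    (hG' : IsMetricFamilyOn G' S V) {K : Set E} (hK : IsCompact K) (hKV : K ⊆ V) (hS : IsCompact S) :
    ∃ N : ℝ, ∀ q ∈ K ×ˢ S, PairBound b (G q.2) (G' q.2) q.1 N := by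
  have hKS : IsCompact (K ×ˢ S) := hK.prod hS
  have hsub : K ×ˢ S ⊆ V ×ˢ S := prod_mono hKV Subset.rfl
  -- a bound for each continuous field on `K × S`
  have bnd : ∀ {F : Type _} [NormedAddCommGroup F] {f : E × ℝ → F},
      ContinuousOn f (V ×ˢ S) → ∃ C, 0 ≤ C ∧ ∀ q ∈ K ×ˢ S, ‖f q‖ ≤ C := by
    intro F _ f hf
    obtain ⟨C, hC⟩ := hKS.exists_bound_of_continuousOn (hf.mono hsub)
    exact ⟨max C 0, le_max_right _ _, fun q hq ↦ (hC q hq).trans (le_max_left _ _)⟩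
  obtain ⟨C₁, h₁, hC₁⟩ := bnd hG.contDiffOn.continuousOn
  obtain ⟨C₂, h₂, hC₂⟩ := bnd hG'.contDiffOn.continuousOn
  obtain ⟨C₃, h₃, hC₃⟩ := bnd hG.contDiffOn_fderiv_family.continuousOn
  obtain ⟨C₄, h₄, hC₄⟩ := bnd hG'.contDiffOn_fderiv_family.continuousOn
  obtain ⟨C₅, h₅, hC₅⟩ := bnd hG.contDiffOn_sharpAt_family.continuousOn
  obtain ⟨C₆, h₆, hC₆⟩ := bnd hG'.contDiffOn_sharpAt_family.continuousOn
  obtain ⟨C₇, h₇, hC₇⟩ := bnd hG.contDiffOn_chrAt_family.continuousOn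
  obtain ⟨C₈, h₈, hC₈⟩ := bnd hG'.contDiffOn_chrAt_family.continuousOn
  obtain ⟨C₉, h₉, hC₉⟩ := bnd hG.contDiffOn_fderiv_chrAt_family.continuousOn
  obtain ⟨C₁₀, h₁₀, hC₁₀⟩ := bnd hG'.contDiffOn_fderiv_chrAt_family.continuousOn
  obtain ⟨C₁₁, h₁₁, hC₁₁⟩ := bnd hG.contDiffOn_ricAt_family.continuousOn
  obtain ⟨C₁₂, h₁₂, hC₁₂⟩ := bnd hG'.contDiffOn_ricAt_family.continuousOn
  obtain ⟨C₁₃, h₁₃, hC₁₃⟩ := bnd hG.contDiffOn_fderiv_ricAt_family.continuousOn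
  obtain ⟨C₁₄, h₁₄, hC₁₄⟩ := bnd hG'.contDiffOn_fderiv_ricAt_family.continuousOn
  obtain ⟨C₁₅, h₁₅, hC₁₅⟩ := bnd hG'.contDiffOn_fderiv_fderiv_ricAt_family.continuousOn
  -- the basis and the dual basis
  haveI : Fintype ι := Fintype.ofFinite ι
  set B₁ : ℝ := ∑ i, ‖b i‖ with hB₁
  set B₂ : ℝ := ∑ i, ‖coordCLM b i‖ with hB₂
  have hb₁ : ∀ i, ‖b i‖ ≤ B₁ := fun i ↦
    Finset.single_le_sum (f := fun i ↦ ‖b i‖) (fun _ _ ↦ norm_nonneg _) (Finset.mem_univ i)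
  have hb₂ : ∀ i, ‖coordCLM b i‖ ≤ B₂ := fun i ↦
    Finset.single_le_sum (f := fun i ↦ ‖coordCLM b i‖) (fun _ _ ↦ norm_nonneg _) (Finset.mem_univ i)
  have hB₁0 : 0 ≤ B₁ := Finset.sum_nonneg fun i _ ↦ norm_nonneg _
  have hB₂0 : 0 ≤ B₂ := Finset.sum_nonneg fun i _ ↦ norm_nonneg _
  set N : ℝ := 1 + C₁ + C₂ + C₃ + C₄ + C₅ + C₆ + C₇ + C₈ + C₉ + C₁₀ + C₁₁ + C₁₂ + C₁₃ + C₁₄ + C₁₅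
    + B₁ + B₂ with hN
  refine ⟨N, fun q hq ↦ ?_⟩
  exact
  { one_le := by rw [hN]; linarith
    metric := (hC₁ q hq).trans (by rw [hN]; linarith)
    metric' := (hC₂ q hq).trans (by rw [hN]; linarith)
    dmetric := (hC₃ q hq).trans (by rw [hN]; linarith)
    dmetric' := (hC₄ q hq).trans (by rw [hN]; linarith)
    sharp := (hC₅ q hq).trans (by rw [hN]; linarith)
    sharp' := (hC₆ q hq).trans (by rw [hN]; linarith)
    chr := (hC₇ q hq).trans (by rw [hN]; linarith)
    chr' := (hC₈ q hq).trans (by rw [hN]; linarith)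
    dchr := (hC₉ q hq).trans (by rw [hN]; linarith)
    dchr' := (hC₁₀ q hq).trans (by rw [hN]; linarith)
    ric := (hC₁₁ q hq).trans (by rw [hN]; linarith)
    ric' := (hC₁₂ q hq).trans (by rw [hN]; linarith)
    dric := (hC₁₃ q hq).trans (by rw [hN]; linarith)
    dric' := (hC₁₄ q hq).trans (by rw [hN]; linarith)
    ddric' := (hC₁₅ q hq).trans (by rw [hN]; linarith)
    basis := fun i ↦ (hb₁ i).trans (by rw [hN]; linarith)
    coord := fun i ↦ (hb₂ i).trans (by rw [hN]; linarith) }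

end PairRegularity

/-! ### Positive definiteness of the inverse metric coefficients -/

section Ellipticity

variable {ι : Type*} [Fintype ι] [FiniteDimensional ℝ E] (b : Basis ι ℝ E)
  {G : E → E →L[ℝ] E →L[ℝ] ℝ} {x : E}

/-- **`g^{ij}` is positive definite when `G` is**: for an invertible, positive definite `G x`,
`Σ_{pq} g^{pq} ξ_p ξ_q = G(♯α, ♯α) > 0` for `ξ ≠ 0`, where `α = Σ ξ_p bᵖ`. [folklore] -/
theorem quadratic_ginv_pos (hi : (G x).IsInvertible) (hpos : ∀ v : E, v ≠ 0 → 0 < G x v v)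
    {ξ : ι → ℝ} (hξ : ξ ≠ 0) : 0 < ∑ p, ∑ q, ginv G b x p q * ξ p * ξ q := by
  set α : E →L[ℝ] ℝ := ∑ p, ξ p • coordCLM b p with hα
  -- `α(b_q) = ξ_q`, so `α ≠ 0`
  have hαb : ∀ q, α (b q) = ξ q := by
    intro q
    simp only [hα, _root_.sum_apply, _root_.smul_apply, coordCLM_apply,
      Basis.coord_apply, Basis.repr_self, smul_eq_mul]
    rw [Finset.sum_eq_single q]
    · simp
    · intro p _ hpq
      rw [Finsupp.single_eq_of_ne hpq, mul_zero]
    · intro h; exact absurd (Finset.mem_univ q) h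
  have hα0 : α ≠ 0 := by
    intro h0
    apply hξ
    funext q
    rw [← hαb q, h0]
    rfl
  -- `v = ♯α ≠ 0`
  set v : E := sharpAt G x α with hv
  have hv0 : v ≠ 0 := by
    intro h0
    apply hα0
    have h := apply_sharpAt hi α
    rw [← hv, h0, map_zero] at h
    exact h.symm
  have hGvv : G x v v = ∑ p, ∑ q, ginv G b x p q * ξ p * ξ q := by
    rw [hv, apply_sharpAt_apply hi]
    conv_lhs => rw [hα]
    simp only [_root_.sum_apply, _root_.smul_apply, smul_eq_mul, coordCLM_apply]
    refine Finset.sum_congr rfl fun p _ ↦ ?_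
    rw [coord_sharpAt_eq_sum b α p, Finset.mul_sum]
    refine Finset.sum_congr rfl fun q _ ↦ ?_
    rw [hαb q]
    ring
  rw [← hGvv]
  exact hpos v hv0

end Ellipticity

/-! ### The time derivative of the energy density along the two flows -/

namespace IsMetricFamilyOn

section TimeDerivative

variable {ι : Type*} [Fintype ι] [FiniteDimensional ℝ E] [CompleteSpace E] (b : Basis ι ℝ E)
  {G G' : ℝ → E → E →L[ℝ] E →L[ℝ] ℝ} {S : Set ℝ} {V : Set E} {y : E} {t : ℝ}
  (hG : IsMetricFamilyOn G S V) (hG' : IsMetricFamilyOn G' S V)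
  (hfl : ∀ s ∈ S, ∀ y ∈ V, tDeriv G S s y = (-2 : ℝ) • ricAt (G s) y)
  (hfl' : ∀ s ∈ S, ∀ y ∈ V, tDeriv G' S s y = (-2 : ℝ) • ricAt (G' s) y)
include hG hG' hfl hfl'

omit [Fintype ι] [CompleteSpace E] in
/-- `∂_t H_{kl} = −2 P_{kl}` within `S`. [cite: Kotschwar2014, §1.1] -/
theorem hasDerivWithinAt_hComp (hy : y ∈ V) (ht : t ∈ S) (p : ι × ι) :
    HasDerivWithinAt (fun s ↦ hComp b (G s) (G' s) y p) (-2 * pComp b (G t) (G' t) y p) S t := by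
  have h1 := hG.hasDerivWithinAt_apply₂ hy ht (b p.1) (b p.2)
  have h2 := hG'.hasDerivWithinAt_apply₂ hy ht (b p.1) (b p.2)
  have h := h1.sub h2
  refine (h.congr_deriv ?_).congr (fun s _ ↦ ?_) ?_
  · rw [hfl t ht y hy, hfl' t ht y hy]
    simp only [_root_.smul_apply, smul_eq_mul, pComp, ricDiff, _root_.sub_apply]
    ring
  · simp [hComp]
  · simp [hComp]

omit [Fintype ι] in
omit hG' hfl' in
/-- **`∂_t Γ = Π` under the flow, static form**: `varChrAt G S t y = piFlowAt (G t) y`.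
[cite: Kotschwar2014, §1.1 (6)] -/
theorem varChrAt_eq_piFlowAt (hy : y ∈ V) (ht : t ∈ S) : varChrAt G S t y = piFlowAt (G t) y :=
  eq_piFlowAt_of_forall ((hG.isMetricOn t ht).isInvertible y hy)
    (fun X Y Z ↦ hG.apply_varChrAt_of_flow hfl ht hy X Y Z)

omit [Fintype ι] in
/-- `∂_t A_{klm} = bᵐ((Π − Π')(b_k, b_l))` within `S`. [cite: Kotschwar2014, §1.1 (6)] -/
theorem hasDerivWithinAt_aComp (hy : y ∈ V) (ht : t ∈ S) (τ : ι × ι × ι) :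
    HasDerivWithinAt (fun s ↦ aComp b (G s) (G' s) y τ) (piComp b (G t) (G' t) y τ) S t := by
  have h1 := hG.hasDerivWithinAt_chrAt hy ht
  have h2 := hG'.hasDerivWithinAt_chrAt hy ht
  have h := h1.sub h2
  have h3 : HasDerivWithinAt (fun s ↦ (chrAt (G s) y - chrAt (G' s) y) (b τ.1) (b τ.2.1))
      ((varChrAt G S t y - varChrAt G' S t y) (b τ.1) (b τ.2.1)) S t := by
    have h' := h.clm_apply (hasDerivWithinAt_const t S (b τ.1))
    simp only [map_zero, add_zero] at h'
    have h'' := h'.clm_apply (hasDerivWithinAt_const t S (b τ.2.1))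
    simpa using h''
  have h4 := (coordCLM b τ.2.2).hasFDerivAt.comp_hasDerivWithinAt t h3
  refine (h4.congr_deriv ?_).congr (fun s _ ↦ ?_) ?_
  · rw [hG.varChrAt_eq_piFlowAt hfl hy ht]
    have h' : varChrAt G' S t y = piFlowAt (G' t) y :=
      eq_piFlowAt_of_forall ((hG'.isMetricOn t ht).isInvertible y hy)
        (fun X Y Z ↦ hG'.apply_varChrAt_of_flow hfl' ht hy X Y Z)
    rw [h']
    rfl
  · rfl
  · rfl

/-- `∂_t P_{kl} = Λ(G)(b_k,b_l) − Λ(G')(b_k,b_l)` within `S` (Hamilton's Cor. 7.3 for both flows).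
[cite: Hamilton1982, Cor. 7.3] -/
theorem hasDerivWithinAt_pComp (hy : y ∈ V) (ht : t ∈ S) (p : ι × ι) :
    HasDerivWithinAt (fun s ↦ pComp b (G s) (G' s) y p)
      (ricEvolAt b (G t) y (b p.1) (b p.2) - ricEvolAt b (G' t) y (b p.1) (b p.2)) S t := by
  have h1 := hG.hasDerivWithinAt_ricAt_ricciFlow b hfl hy ht (b p.1) (b p.2)
  have h2 := hG'.hasDerivWithinAt_ricAt_ricciFlow b hfl' hy ht (b p.1) (b p.2)
  refine ((h1.sub h2).congr_deriv ?_).congr (fun s _ ↦ ?_) ?_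
  · simp only [ricEvolAt, ricReactAt, reactTerm]
  · simp [pComp, ricDiff]
  · simp [pComp, ricDiff]

/-- **The time derivative of the energy density along the two flows is `eDeriv`** (within `S`,
valid up to the end points). [cite: Kotschwar2014, §2.3] -/
theorem hasDerivWithinAt_eDens (hy : y ∈ V) (ht : t ∈ S) :
    HasDerivWithinAt (fun s ↦ eDens b (G s) (G' s) y) (eDeriv b (G t) (G' t) y) S t := by
  have hH : ∀ p, HasDerivWithinAt (fun s ↦ hComp b (G s) (G' s) y p ^ 2)
      (2 * hComp b (G t) (G' t) y p * (-2 * pComp b (G t) (G' t) y p)) S t := fun p ↦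
    ((hG.hasDerivWithinAt_hComp b hG' hfl hfl' hy ht p).pow 2).congr_deriv (by norm_num)
  have hA : ∀ τ, HasDerivWithinAt (fun s ↦ aComp b (G s) (G' s) y τ ^ 2)
      (2 * aComp b (G t) (G' t) y τ * piComp b (G t) (G' t) y τ) S t := fun τ ↦
    ((hG.hasDerivWithinAt_aComp b hG' hfl hfl' hy ht τ).pow 2).congr_deriv (by norm_num)
  have hP : ∀ p, HasDerivWithinAt (fun s ↦ pComp b (G s) (G' s) y p ^ 2)
      (2 * pComp b (G t) (G' t) y p *
        (ricEvolAt b (G t) y (b p.1) (b p.2) - ricEvolAt b (G' t) y (b p.1) (b p.2))) S t := fun p ↦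
    ((hG.hasDerivWithinAt_pComp b hG' hfl hfl' hy ht p).pow 2).congr_deriv (by norm_num)
  have hsum := ((HasDerivWithinAt.fun_sum (u := Finset.univ) fun p _ ↦ hH p).add
    (HasDerivWithinAt.fun_sum (u := Finset.univ) fun τ _ ↦ hA τ)).add
    (HasDerivWithinAt.fun_sum (u := Finset.univ) fun p _ ↦ hP p)
  exact hsum

end TimeDerivative

end IsMetricFamilyOn

/-! ### Chart energies: continuity in time and differentiation under the integral sign -/

section Parametric

variable [MeasurableSpace E] [BorelSpace E] {μ : Measure E} [FiniteDimensional ℝ E]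
  [μ.IsAddHaarMeasure] {V : Set E} {S : Set ℝ} {ρ : E → ℝ}

omit [NormedSpace ℝ E] [FiniteDimensional ℝ E] [μ.IsAddHaarMeasure] [BorelSpace E] [MeasurableSpace E] in
/-- A uniform bound `|ρ| ≤ R₀` for a continuous compactly supported `ρ`. [folklore] -/
theorem exists_bound_of_hasCompactSupport (hρ : Continuous ρ) (hρc : HasCompactSupport ρ) :
    ∃ R₀ : ℝ, 0 ≤ R₀ ∧ ∀ x, |ρ x| ≤ R₀ := by
  obtain ⟨C, hC⟩ := hρ.bounded_above_of_compact_support hρc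
  refine ⟨max C 0, le_max_right _ _, fun x ↦ ?_⟩
  rw [← Real.norm_eq_abs]
  exact (hC x).trans (le_max_left _ _)

omit [NormedSpace ℝ E] [FiniteDimensional ℝ E] [μ.IsAddHaarMeasure] in
/-- **Continuity in time of a chart energy.** If `F` is jointly continuous on `V × S`, `S`
compact, and `ρ` is continuous with compact support in the open set `V`, then
`t ↦ ∫ ρ² F(t, ·) dμ` is continuous on `S` (dominated convergence with the bound
`R₀² · max |F| · 𝟙_{tsupport ρ}`). [folklore] -/
theorem continuousOn_integral_rhoSq_mul [IsFiniteMeasureOnCompacts μ] (hV : IsOpen V) (hS : IsCompact S) (hρ : Continuous ρ)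
    (hρc : HasCompactSupport ρ) (hρV : tsupport ρ ⊆ V) {F : ℝ → E → ℝ}
    (hF : ContinuousOn (fun q : E × ℝ ↦ F q.2 q.1) (V ×ˢ S)) :
    ContinuousOn (fun t ↦ ∫ y, ρ y ^ 2 * F t y ∂μ) S := by
  have hK : IsCompact (tsupport ρ) := hρc
  have hKm : MeasurableSet (tsupport ρ) := (isClosed_tsupport ρ).measurableSet
  obtain ⟨R₀, hR₀0, hR₀⟩ := exists_bound_of_hasCompactSupport hρ hρc
  obtain ⟨M, hM⟩ := (hK.prod hS).exists_bound_of_continuousOn (hF.mono (prod_mono hρV Subset.rfl))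
  have hρ0 : ∀ y ∉ tsupport ρ, ρ y = 0 := fun y hy ↦ image_eq_zero_of_notMem_tsupport hy
  -- slices
  have hFt : ∀ t ∈ S, ContinuousOn (F t) V := fun t ht ↦
    hF.comp (continuousOn_id.prodMk continuousOn_const) fun y hy ↦ ⟨hy, ht⟩
  have hFy : ∀ y ∈ V, ContinuousOn (fun t ↦ F t y) S := fun y hy ↦
    hF.comp (continuousOn_const.prodMk continuousOn_id) fun t ht ↦ ⟨hy, ht⟩
  have hcont : ∀ t ∈ S, Continuous fun y ↦ ρ y ^ 2 * F t y := fun t ht ↦ by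
    have hρ2V : tsupport (fun x ↦ ρ x ^ 2) ⊆ V := by
      rw [show (fun y ↦ ρ y ^ 2) = fun y ↦ ρ y * ρ y from funext fun y ↦ sq (ρ y)]
      exact tsupport_mul_subset_left.trans hρV
    exact continuous_mul_of_tsupport_subset hV (hρ.pow 2) hρ2V (hFt t ht)
  refine continuousOn_of_dominated (bound := (tsupport ρ).indicator fun _ ↦ R₀ ^ 2 * max M 0)
    (fun t ht ↦ (hcont t ht).aestronglyMeasurable) (fun t ht ↦ Eventually.of_forall fun y ↦ ?_) ?_
    (Eventually.of_forall fun y ↦ ?_)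
  · by_cases hy : y ∈ tsupport ρ
    · rw [indicator_of_mem hy, Real.norm_eq_abs, abs_mul, abs_pow]
      have h1 : |ρ y| ^ 2 ≤ R₀ ^ 2 := pow_le_pow_left₀ (abs_nonneg _) (hR₀ y) 2
      have h2 : |F t y| ≤ max M 0 := by
        have := hM (y, t) ⟨hy, ht⟩
        rw [Real.norm_eq_abs] at this
        exact this.trans (le_max_left _ _)
      exact mul_le_mul h1 h2 (abs_nonneg _) (by positivity)
    · rw [indicator_of_notMem hy, hρ0 y hy]
      simp
  · rw [integrable_indicator_iff hKm]
    haveI : IsFiniteMeasure (μ.restrict (tsupport ρ)) := isFiniteMeasure_restrict.2 hK.measure_lt_top.ne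
    exact integrable_const _
  · by_cases hy : y ∈ V
    · exact continuousOn_const.mul (hFy y hy)
    · have hy' : y ∉ tsupport ρ := fun h ↦ hy (hρV h)
      simp only [hρ0 y hy']
      simpa using continuousOn_const

omit [NormedSpace ℝ E] [FiniteDimensional ℝ E] [μ.IsAddHaarMeasure] in
/-- **Continuity in time of the energy content of a compact set.** If `F` is jointly continuous on
`V × S`, `S` compact, `K ⊆ V` compact, then `t ↦ ∫_K F(t, ·) dμ` is continuous on `S`. [folklore] -/
theorem continuousOn_setIntegral_of_continuousOn [IsFiniteMeasureOnCompacts μ] (hS : IsCompact S) {K : Set E} (hK : IsCompact K)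
    (hKV : K ⊆ V) {F : ℝ → E → ℝ} (hF : ContinuousOn (fun q : E × ℝ ↦ F q.2 q.1) (V ×ˢ S)) :
    ContinuousOn (fun t ↦ ∫ y in K, F t y ∂μ) S := by
  have hKm : MeasurableSet K := hK.isClosed.measurableSet
  obtain ⟨M, hM⟩ := (hK.prod hS).exists_bound_of_continuousOn (hF.mono (prod_mono hKV Subset.rfl))
  have hFt : ∀ t ∈ S, ContinuousOn (F t) K := fun t ht ↦
    hF.comp (continuousOn_id.prodMk continuousOn_const) fun y hy ↦ ⟨hKV hy, ht⟩
  have hFy : ∀ y ∈ K, ContinuousOn (fun t ↦ F t y) S := fun y hy ↦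
    hF.comp (continuousOn_const.prodMk continuousOn_id) fun t ht ↦ ⟨hKV hy, ht⟩
  haveI : IsFiniteMeasure (μ.restrict K) := isFiniteMeasure_restrict.2 hK.measure_lt_top.ne
  refine continuousOn_of_dominated (μ := μ.restrict K) (bound := fun _ ↦ M)
    (fun t ht ↦ (hFt t ht).aestronglyMeasurable hKm) (fun t ht ↦ ?_) (integrable_const _) ?_
  · filter_upwards [ae_restrict_mem hKm] with y hy
    exact hM (y, t) ⟨hy, ht⟩
  · filter_upwards [ae_restrict_mem hKm] with y hy
    exact hFy y hy

omit [FiniteDimensional ℝ E] in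
/-- **Differentiation of a chart energy under the integral sign** at interior times. If `F, F'`
are jointly continuous on `V × [0, T]` and `t ↦ F(t, y)` has derivative `F'(t, y)` at every
`t ∈ (0, T)` for `y ∈ V`, then for a `C¹` cut-off `ρ` with compact support in the open set `V`,
`d/dt ∫ ρ² F(t, ·) dμ = ∫ ρ² F'(t, ·) dμ` at every `t₀ ∈ (0, T)` (dominated differentiation,
Mathlib's `hasDerivAt_integral_of_dominated_loc_of_deriv_le`). [folklore] -/
theorem hasDerivAt_integral_rhoSq_mul (hV : IsOpen V) {T : ℝ}
    (hρ : ContDiff ℝ 1 ρ) (hρc : HasCompactSupport ρ) (hρV : tsupport ρ ⊆ V) {F F' : ℝ → E → ℝ}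
    (hF : ContinuousOn (fun q : E × ℝ ↦ F q.2 q.1) (V ×ˢ Icc 0 T))
    (hF' : ContinuousOn (fun q : E × ℝ ↦ F' q.2 q.1) (V ×ˢ Icc 0 T))
    (hd : ∀ y ∈ V, ∀ t ∈ Ioo 0 T, HasDerivAt (fun s ↦ F s y) (F' t y) t)
    {t₀ : ℝ} (ht₀ : t₀ ∈ Ioo 0 T) :
    HasDerivAt (fun t ↦ ∫ y, ρ y ^ 2 * F t y ∂μ) (∫ y, ρ y ^ 2 * F' t₀ y ∂μ) t₀ := by
  have ht₀' : t₀ ∈ Icc 0 T := Ioo_subset_Icc_self ht₀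
  have hK : IsCompact (tsupport ρ) := hρc
  have hKm : MeasurableSet (tsupport ρ) := (isClosed_tsupport ρ).measurableSet
  have hρ0 : ∀ y ∉ tsupport ρ, ρ y = 0 := fun y hy ↦ image_eq_zero_of_notMem_tsupport hy
  have hS : IsCompact (Icc (0 : ℝ) T) := isCompact_Icc
  obtain ⟨R₀, hR₀0, hR₀⟩ := exists_bound_of_hasCompactSupport hρ.continuous hρc
  obtain ⟨M, hM⟩ := (hK.prod hS).exists_bound_of_continuousOn (hF'.mono (prod_mono hρV Subset.rfl))
  have hρ2V : tsupport (fun x ↦ ρ x ^ 2) ⊆ V := by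
    rw [show (fun y ↦ ρ y ^ 2) = fun y ↦ ρ y * ρ y from funext fun y ↦ sq (ρ y)]
    exact tsupport_mul_subset_left.trans hρV
  have hρ2 : Continuous fun x ↦ ρ x ^ 2 := hρ.continuous.pow 2
  -- slices of the joint continuity
  have hFt : ∀ t ∈ Icc 0 T, ContinuousOn (F t) V := fun t ht ↦
    hF.comp (continuousOn_id.prodMk continuousOn_const) fun y hy ↦ ⟨hy, ht⟩
  have hF't : ∀ t ∈ Icc 0 T, ContinuousOn (F' t) V := fun t ht ↦
    hF'.comp (continuousOn_id.prodMk continuousOn_const) fun y hy ↦ ⟨hy, ht⟩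
  have hs : Ioo 0 T ∈ 𝓝 t₀ := Ioo_mem_nhds ht₀.1 ht₀.2
  have hmeas : ∀ᶠ t in 𝓝 t₀, AEStronglyMeasurable (fun y ↦ ρ y ^ 2 * F t y) μ := by
    filter_upwards [hs] with t ht
    exact (continuous_mul_of_tsupport_subset hV hρ2 hρ2V (hFt t (Ioo_subset_Icc_self ht))).aestronglyMeasurable
  have hint : Integrable (fun y ↦ ρ y ^ 2 * F t₀ y) μ := integrable_rhoSq_mul hV hρ hρc hρV (hFt t₀ ht₀')
  have hmeas' : AEStronglyMeasurable (fun y ↦ ρ y ^ 2 * F' t₀ y) μ :=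
    (continuous_mul_of_tsupport_subset hV hρ2 hρ2V (hF't t₀ ht₀')).aestronglyMeasurable
  have hbound : ∀ᵐ y ∂μ, ∀ t ∈ Ioo 0 T,
      ‖ρ y ^ 2 * F' t y‖ ≤ (tsupport ρ).indicator (fun _ ↦ R₀ ^ 2 * max M 0) y := by
    refine Eventually.of_forall fun y t ht ↦ ?_
    by_cases hy : y ∈ tsupport ρ
    · rw [indicator_of_mem hy, Real.norm_eq_abs, abs_mul, abs_pow]
      have h1 : |ρ y| ^ 2 ≤ R₀ ^ 2 := pow_le_pow_left₀ (abs_nonneg _) (hR₀ y) 2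
      have h2 : |F' t y| ≤ max M 0 := by
        have := hM (y, t) ⟨hy, Ioo_subset_Icc_self ht⟩
        rw [Real.norm_eq_abs] at this
        exact this.trans (le_max_left _ _)
      exact mul_le_mul h1 h2 (abs_nonneg _) (by positivity)
    · rw [indicator_of_notMem hy, hρ0 y hy]
      simp
  have hbint : Integrable ((tsupport ρ).indicator (fun _ ↦ R₀ ^ 2 * max M 0)) μ := by
    rw [integrable_indicator_iff hKm]
    haveI : IsFiniteMeasure (μ.restrict (tsupport ρ)) := isFiniteMeasure_restrict.2 hK.measure_lt_top.ne
    exact integrable_const _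
  have hdiff : ∀ᵐ y ∂μ, ∀ t ∈ Ioo 0 T, HasDerivAt (fun s ↦ ρ y ^ 2 * F s y) (ρ y ^ 2 * F' t y) t := by
    refine Eventually.of_forall fun y t ht ↦ ?_
    by_cases hy : y ∈ V
    · exact (hd y hy t ht).const_mul (ρ y ^ 2)
    · have hy' : y ∉ tsupport ρ := fun h ↦ hy (hρV h)
      have hzero : (fun s ↦ ρ y ^ 2 * F s y) = fun _ ↦ 0 := by
        funext s; rw [hρ0 y hy']; ring
      rw [hzero, hρ0 y hy', zero_pow two_ne_zero, zero_mul]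
      exact hasDerivAt_const t (0 : ℝ)
  exact (hasDerivAt_integral_of_dominated_loc_of_deriv_le hs hmeas hint hmeas' hbound hbint hdiff).2

end Parametric

/-! ### The integrated localized energy inequality -/

namespace IsMetricFamilyOn

section Energy

variable [MeasurableSpace E] [BorelSpace E] {μ : Measure E} {ι : Type*} [Fintype ι] [FiniteDimensional ℝ E]
  [μ.IsAddHaarMeasure] [CompleteSpace E] (b : Basis ι ℝ E)
  {G G' : ℝ → E → E →L[ℝ] E →L[ℝ] ℝ} {T : ℝ} {V : Set E} {ρ : E → ℝ}
  (hG : IsMetricFamilyOn G (Icc 0 T) V) (hG' : IsMetricFamilyOn G' (Icc 0 T) V)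
  (hfl : ∀ s ∈ Icc 0 T, ∀ y ∈ V, tDeriv G (Icc 0 T) s y = (-2 : ℝ) • ricAt (G s) y)
  (hfl' : ∀ s ∈ Icc 0 T, ∀ y ∈ V, tDeriv G' (Icc 0 T) s y = (-2 : ℝ) • ricAt (G' s) y)
  (hρ : ContDiff ℝ 1 ρ) (hρc : HasCompactSupport ρ) (hρV : tsupport ρ ⊆ V)
include hG hG' hρ hρc hρV

/-- The chart energy `t ↦ ∫ ρ² e(t)` is continuous on `[0, T]`. [cite: Kotschwar2014, §2.3] -/
theorem continuousOn_energy :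
    ContinuousOn (fun t ↦ ∫ y, ρ y ^ 2 * eDens b (G t) (G' t) y ∂μ) (Icc 0 T) := by
  by_cases hS : Icc (0 : ℝ) T = ∅
  · rw [hS]; exact continuousOn_empty _
  obtain ⟨t₀, ht₀⟩ := Set.nonempty_iff_ne_empty.mpr hS
  exact continuousOn_integral_rhoSq_mul (hG.isOpen ht₀) isCompact_Icc hρ.continuous hρc hρV
    (hG.continuousOn_eDens_family b hG')

omit hρ hρc hρV in
/-- The energy content `t ↦ ∫_K e(t)` of a compact `K ⊆ V` is continuous on `[0, T]`.
[cite: Kotschwar2014, §2.3] -/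
theorem continuousOn_setIntegral_eDens {K : Set E} (hK : IsCompact K) (hKV : K ⊆ V) :
    ContinuousOn (fun t ↦ ∫ y in K, eDens b (G t) (G' t) y ∂μ) (Icc 0 T) :=
  continuousOn_setIntegral_of_continuousOn isCompact_Icc hK hKV (hG.continuousOn_eDens_family b hG')

/-- `t ↦ ∫ ρ² (∂_t e)(t)` is continuous on `[0, T]`. [cite: Kotschwar2014, §2.3] -/
theorem continuousOn_integral_rhoSq_eDeriv :
    ContinuousOn (fun t ↦ ∫ y, ρ y ^ 2 * eDeriv b (G t) (G' t) y ∂μ) (Icc 0 T) := by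
  by_cases hS : Icc (0 : ℝ) T = ∅
  · rw [hS]; exact continuousOn_empty _
  obtain ⟨t₀, ht₀⟩ := Set.nonempty_iff_ne_empty.mpr hS
  exact continuousOn_integral_rhoSq_mul (hG.isOpen ht₀) isCompact_Icc hρ.continuous hρc hρV
    (hG.continuousOn_eDeriv_family b hG')

include hfl hfl' in
/-- **Differentiation of the chart energy under the integral sign** at interior times:
`d/dt ∫ ρ² e(t) = ∫ ρ² (∂_t e)(t)` for `t ∈ (0, T)`. [cite: Kotschwar2014, §2.3] -/
theorem hasDerivAt_energy {t₀ : ℝ} (ht₀ : t₀ ∈ Ioo 0 T) :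
    HasDerivAt (fun t ↦ ∫ y, ρ y ^ 2 * eDens b (G t) (G' t) y ∂μ)
      (∫ y, ρ y ^ 2 * eDeriv b (G t₀) (G' t₀) y ∂μ) t₀ := by
  have hV : IsOpen V := hG.isOpen (Ioo_subset_Icc_self ht₀)
  refine hasDerivAt_integral_rhoSq_mul (F := fun t y ↦ eDens b (G t) (G' t) y)
    (F' := fun t y ↦ eDeriv b (G t) (G' t) y) hV hρ hρc hρV (hG.continuousOn_eDens_family b hG')
    (hG.continuousOn_eDeriv_family b hG') (fun y hy t ht ↦ ?_) ht₀
  exact (hG.hasDerivWithinAt_eDens b hG' hfl hfl' hy (Ioo_subset_Icc_self ht)).hasDerivAt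
    (Icc_mem_nhds ht.1 ht.2)

include hfl hfl' in
/-- **The integrated localized energy inequality** (Kotschwar 2014, Prop. 7, `ℰ' ≤ Nℰ`, in
integrated form on one chart). Let `N` bound the background quantities of the pair on
`(tsupport ρ) × [0, T]` and `λ > 0` be an ellipticity constant of `g^{ij}` there, `|ρ| ≤ R₀`,
`‖Dρ‖ ≤ R₁`. Then for every `t ∈ [0, T]`

  `∫ ρ² e(t) dμ ≤ ∫ ρ² e(0) dμ + C ∫₀ᵗ ( ∫_{tsupport ρ} e(s) dμ ) ds`,  `C = energyConst n N λ R₀ R₁`.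

[cite: Kotschwar2014, §2.3, Prop. 7] -/
theorem energy_le [Nonempty ι] {N lam R₀ R₁ : ℝ} (hlam : 0 < lam)
    (hN : ∀ s ∈ Icc 0 T, ∀ x ∈ tsupport ρ, PairBound b (G s) (G' s) x N)
    (hell : ∀ s ∈ Icc 0 T, ∀ x ∈ tsupport ρ, ∀ ξ : ι → ℝ,
      lam * ∑ j, ξ j ^ 2 ≤ ∑ i, ∑ j, ginv (G s) b x i j * ξ i * ξ j)
    (hR₀ : ∀ x, |ρ x| ≤ R₀) (hR₁ : ∀ x, ‖fderiv ℝ ρ x‖ ≤ R₁) {t : ℝ} (ht : t ∈ Icc 0 T) :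
    ∫ y, ρ y ^ 2 * eDens b (G t) (G' t) y ∂μ ≤
      (∫ y, ρ y ^ 2 * eDens b (G 0) (G' 0) y ∂μ)
        + energyConst (Fintype.card ι) N lam R₀ R₁ *
          ∫ s in (0 : ℝ)..t, ∫ y in tsupport ρ, eDens b (G s) (G' s) y ∂μ := by
  set C := energyConst (Fintype.card ι) N lam R₀ R₁ with hC
  set En : ℝ → ℝ := fun t ↦ ∫ y, ρ y ^ 2 * eDens b (G t) (G' t) y ∂μ with hEn
  set En' : ℝ → ℝ := fun t ↦ ∫ y, ρ y ^ 2 * eDeriv b (G t) (G' t) y ∂μ with hEn'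
  set Q : ℝ → ℝ := fun s ↦ ∫ y in tsupport ρ, eDens b (G s) (G' s) y ∂μ with hQ
  have hK : IsCompact (tsupport ρ) := hρc
  have hsub : Icc 0 t ⊆ Icc 0 T := Icc_subset_Icc le_rfl ht.2
  -- FTC on `[0, t]`
  have hcont : ContinuousOn En (Icc 0 t) := (hG.continuousOn_energy b hG' hρ hρc hρV).mono hsub
  have hderiv : ∀ s ∈ Ioo 0 t, HasDerivAt En (En' s) s := fun s hs ↦
    hG.hasDerivAt_energy b hG' hfl hfl' hρ hρc hρV ⟨hs.1, hs.2.trans_le ht.2⟩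
  have hEn'c : ContinuousOn En' (Icc 0 t) :=
    (hG.continuousOn_integral_rhoSq_eDeriv b hG' hρ hρc hρV).mono hsub
  have hQc : ContinuousOn Q (Icc 0 t) :=
    (hG.continuousOn_setIntegral_eDens b hG' hK hρV).mono hsub
  have hint : IntervalIntegrable En' volume 0 t := hEn'c.intervalIntegrable_of_Icc ht.1
  have hFTC : ∫ s in (0 : ℝ)..t, En' s = En t - En 0 :=
    intervalIntegral.integral_eq_sub_of_hasDerivAt_of_le ht.1 hcont hderiv hint
  -- the localized energy inequality at each time
  have hle : ∀ s ∈ Icc 0 t, En' s ≤ C * Q s := fun s hs ↦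
    integral_rhoSq_eDeriv_le (hG.isMetricOn s (hsub hs)) (hG'.isMetricOn s (hsub hs)) hρ hρc hρV hlam
      (fun x hx ↦ hN s (hsub hs) x hx) (fun x hx ↦ hell s (hsub hs) x hx) hR₀ hR₁
  have hmono : ∫ s in (0 : ℝ)..t, En' s ≤ ∫ s in (0 : ℝ)..t, C * Q s :=
    intervalIntegral.integral_mono_on ht.1 hint ((hQc.intervalIntegrable_of_Icc ht.1).const_mul C) hle
  rw [intervalIntegral.integral_const_mul] at hmono
  change En t ≤ En 0 + C * ∫ s in (0 : ℝ)..t, Q s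
  linarith [hFTC, hmono]

end Energy

end IsMetricFamilyOn

end MetricCoord

end Literature.Geometry.Lorentzian

end
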